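import Literature.NumberTheory.Transcendental.KZProduct
import Summits.KontsevichZagierPeriods.KontsevichZagierPeriods.Theorems.AyoubSpecialisationAssembly

/-!
# The kernel conjecture is the `π`-localised pair: `KZKernelConjecture ↔ KZ.PiLocalKernel ∧ KZ.PiCancellation`

One closed biconditional: the pivot `X′ := PiLocalKernel ∧ PiCancellation` of route AyoubSpecialisation
(thesis stmt-KontsevichZagierPeriods-0538, in the Literature shape `KZ.PiLocalKernel ∧ KZ.PiCancellation`
its docstring announces; items stmt-KontsevichZagierPeriods-0541 / -0540) is EXACTLY the kernel form
`Literature.NumberTheory.Transcendental.KZKernelConjecture` (`ker eval = relations`) of Kontsevich–Zagier's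
Conjecture 1 — so the pivot is summit-strength, neither weaker nor stronger. The same biconditional is
the `π`-half of the residual certificate of the crux `NormalFormPrinciple` of route HurwitzMicroSectors
(stmt-KontsevichZagierPeriods-3869, `…NormalFormPrinciple.PiBox.normalFormPrinciple_iff_piLocalKernel_and_piCancellation`).
Both halves are already in the tree and are only PAIRED here, not re-proved:

* `→` is the Literature lemma `KZ.piLocalKernel_and_piCancellation_of_kernel` (exponent `N := 0`;
  soundness `KZ.relations_le_ker_eval_holds` with `eval ([π]·c) = π · eval c`, `π ≠ 0`);
* `←` is the assembly `AyoubSpecialisation.kzKernelConjecture_of_piLocalKernel_of_piCancellation`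
  (item stmt-KontsevichZagierPeriods-0539, stated for an arbitrary biadditive product and element:
  peel one factor at a time by induction on the exponent), instantiated at `mul := KZ.FormalRep.mul`
  (`= (· * ·)` on `FormalRep`, `KZ.FormalRep.mul_apply`) and `p := of piRep`, as its docstring foresaw.

Informally: evaluation is injective on the formal effective period ring `FormalRep ⧸ relations` iff it
is injective after inverting `[π]` AND `[π]` is a non-zero-divisor there — Kontsevich–Zagier's passage
`P̂ = P[(2πi)⁻¹]` (*Periods*, 2001, §4.1, p. 31) read in both directions; J. Ayoub, *Periods and the
conjectures of Grothendieck and Kontsevich–Zagier*, EMS Newsl. 91 (2014), Def. 6 / Conj. 7. Nothing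
here asserts either side: all three Props are open conjectures.
-/

namespace Summit.KontsevichZagierPeriods.AyoubSpecialisation

open Literature.NumberTheory.Transcendental Literature.NumberTheory.Transcendental.KZ

/-- **`(ker eval = relations) ↔ PiLocalKernel ∧ PiCancellation`** for the Kontsevich–Zagier calculus
of moves: the kernel conjecture `KZKernelConjecture` holds iff every formal combination of value `0`
becomes a relation after multiplication by a power of `[π]` (`KZ.PiLocalKernel`) and `[π]·c ∈ relations`
forces `c ∈ relations` (`KZ.PiCancellation`). `→`: `KZ.piLocalKernel_and_piCancellation_of_kernel`
with soundness `KZ.relations_le_ker_eval_holds`; `←`: the assembly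
`kzKernelConjecture_of_piLocalKernel_of_piCancellation` at `KZ.FormalRep.mul`, `of piRep`.
[cite: Ayoub2014, Def. 6 and Conj. 7] -/
theorem kzKernelConjecture_iff_piLocalKernel_and_piCancellation :
    KZKernelConjecture ↔ (PiLocalKernel ∧ PiCancellation) :=
  ⟨piLocalKernel_and_piCancellation_of_kernel relations_le_ker_eval_holds,
    fun h => kzKernelConjecture_of_piLocalKernel_of_piCancellation FormalRep.mul (of piRep) h.1 h.2⟩

end Summit.KontsevichZagierPeriods.AyoubSpecialisation
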